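import Mathlib
import Summits.Ventures.PercRepro2.Defs
import Summits.Ventures.PercRepro2.Harris
import Summits.Ventures.PercRepro2.CoinDefs
import Summits.Ventures.PercRepro2.CoinStarDefs
import Summits.Ventures.PercRepro2.CoinLsmCoreDefs
import Summits.Ventures.PercRepro2.CoinOrTailKDefs
import Summits.Ventures.PercRepro2.CoinOrTailKSums
import Summits.Ventures.PercRepro2.CoinK2HeadBlindVals

/-!
# The OR-tail level reduction for a GENERAL head function, and the OR-closure of a head
(blind cell PercRepro2, night-2 g15; proofs/NIGHT2-DARC.md §53)

`OrTailK.sum_gen` / `sum_gen_tail`: the core sums over `U ∪ {a}` of `ν_{U ∪ {a}}(W) · F W · m W`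
reduce to sums over `U` of `ν_U(W) · (tailWtK W · F W + (1 − tailWtK W) · F (W ∪ {a})) · m W` for
ANY function `F` of the level (the §41 lemmas `sum_R_eq` / `sum_G_eq` are the cases
`F = A`, `F = A ∘ starTarget`); with a marker vanishing off `a` the entered part alone remains.
`closeB entb b F W = F (W ∪ {b})` if `W` meets `entb`, else `F W` — the head seen through a
SURE OR-vertex `b` entered from `entb`; it is nonnegative, decreasing and log-supermodular
whenever `F` is (`closeB_nonneg`, `closeB_mono`, `closeB_lsm`), and the sure-coin mixture of
`F` and `F (· ∪ {b})` is exactly `closeB` (`closeB_of_sure`).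
-/

namespace Summit.Ventures.PercRepro2.Coin

open Classical

section GenSums

variable {V : Type*} {E : Type*} [DecidableEq V] [Fintype E] [DecidableEq E]
  {R : Type*} [Field R]
  {arcs : E → Finset (V × V)} {s : V} {U : Finset V} {ent : Finset V} {c : V → E} {a : V}

/-- **The level reduction for a general head function** (a marker constant in `a`). -/
lemma OrTailK.sum_gen (h : OrTailK arcs s U ent c a) (pr : E → R) (F m : Finset V → R)
    (hm : ∀ W, m (insert a W) = m W) :
    ∑ W ∈ (insert a U).powerset, prob pr (coreLevel arcs s (insert a U) W) * F W * m W =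
      ∑ W ∈ U.powerset, prob pr (coreLevel arcs s U W) *
        (tailWtK pr ent c W * F W + (1 - tailWtK pr ent c W) * F (W ∪ {a})) * m W := by
  rw [Finset.sum_powerset_insert h.a_notin, ← Finset.sum_add_distrib]
  refine Finset.sum_congr rfl fun W hW => ?_
  have hWU : W ⊆ U := Finset.mem_powerset.1 hW
  have haW : a ∉ W := fun haW => h.a_notin (hWU haW)
  have haE : a ∉ ent := fun he => h.a_notin (h.ent_sub he)
  have hins : insert a W = W ∪ {a} := by rw [Finset.insert_eq, Finset.union_comm]
  rw [h.prob_coreLevel_eq pr W, h.prob_coreLevel_eq pr (insert a W),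
    h.prob_tailEventK pr W, h.prob_tailEventK pr (insert a W), hm W,
    Finset.insert_inter_of_notMem h.a_notin, Finset.inter_eq_left.2 hWU,
    tailWtK_insert_a pr c haE W]
  simp only [haW, Finset.mem_insert_self, if_true, if_false]
  rw [hins]
  ring

/-- **The level reduction for a general head function and a marker vanishing off `a`.** -/
lemma OrTailK.sum_gen_tail (h : OrTailK arcs s U ent c a) (pr : E → R) (F g m : Finset V → R)
    (hg0 : ∀ W, a ∉ W → g W = 0) (hg1 : ∀ W, a ∉ W → g (insert a W) = m W) :
    ∑ W ∈ (insert a U).powerset, prob pr (coreLevel arcs s (insert a U) W) * F W * g W =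
      ∑ W ∈ U.powerset, prob pr (coreLevel arcs s U W) *
        ((1 - tailWtK pr ent c W) * F (W ∪ {a})) * m W := by
  rw [Finset.sum_powerset_insert h.a_notin, ← Finset.sum_add_distrib]
  refine Finset.sum_congr rfl fun W hW => ?_
  have hWU : W ⊆ U := Finset.mem_powerset.1 hW
  have haW : a ∉ W := fun haW => h.a_notin (hWU haW)
  have haE : a ∉ ent := fun he => h.a_notin (h.ent_sub he)
  have hins : insert a W = W ∪ {a} := by rw [Finset.insert_eq, Finset.union_comm]
  rw [hg0 W haW, hg1 W haW, h.prob_coreLevel_eq pr (insert a W),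
    h.prob_tailEventK pr (insert a W), Finset.insert_inter_of_notMem h.a_notin,
    Finset.inter_eq_left.2 hWU, tailWtK_insert_a pr c haE W]
  simp only [Finset.mem_insert_self, if_true, mul_zero, zero_add]
  rw [hins]
  ring

omit [Fintype E] [DecidableEq E] in
/-- `starTarget` commutes with adding a vertex other than `u`. -/
lemma starTarget_union_singleton (u w : V) (W : Finset V) {b : V} (hb : b ≠ u) :
    starTarget u w (W ∪ {b}) = starTarget u w W ∪ {b} := by
  unfold starTarget
  have : u ∈ W ∪ {b} ↔ u ∈ W := by
    rw [Finset.mem_union, Finset.mem_singleton]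
    exact or_iff_left (Ne.symm hb)
  by_cases hu : u ∈ W
  · rw [if_pos (this.2 hu), if_pos hu, Finset.insert_union]
  · rw [if_neg (fun h => hu (this.1 h)), if_neg hu]

end GenSums

section CloseB

variable {V : Type*} {E : Type*} [DecidableEq V] {R : Type*} [Field R] [LinearOrder R]
  [IsStrictOrderedRing R]

/-- The head seen through a SURE OR-vertex `b` entered from `entb`: `F (W ∪ {b})` when `W`
meets `entb`, `F W` otherwise. -/
noncomputable def closeB (entb : Finset V) (b : V) (F : Finset V → R) (W : Finset V) : R :=
  if ∃ r ∈ entb, r ∈ W then F (W ∪ {b}) else F W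

omit [LinearOrder R] [IsStrictOrderedRing R] in
/-- The sure-coin mixture of `F` and `F (· ∪ {b})` is `closeB`. -/
lemma closeB_of_sure (pr : E → R) {entb : Finset V} (d : V → E) (b : V) (F : Finset V → R)
    (hsure : ∀ r ∈ entb, pr (d r) = 1) (W : Finset V) :
    tailWtK pr entb d W * F W + (1 - tailWtK pr entb d W) * F (W ∪ {b}) = closeB entb b F W := by
  unfold closeB
  rw [tailWtK_sure pr d hsure W]
  split_ifs <;> ring

omit [LinearOrder R] [IsStrictOrderedRing R] in
/-- The entered part of the sure-coin mixture is `closeB` times the entry indicator. -/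
lemma closeB_of_sure_tail (pr : E → R) {entb : Finset V} (d : V → E) (b : V) (F : Finset V → R)
    (hsure : ∀ r ∈ entb, pr (d r) = 1) (W : Finset V) :
    (1 - tailWtK pr entb d W) * F (W ∪ {b}) =
      closeB entb b F W * (if ∃ r ∈ entb, r ∈ W then (1 : R) else 0) := by
  unfold closeB
  rw [tailWtK_sure pr d hsure W]
  split_ifs <;> ring

omit [IsStrictOrderedRing R] in
/-- `closeB` of a nonnegative head is nonnegative. -/
lemma closeB_nonneg (entb : Finset V) (b : V) (F : Finset V → R) (hF0 : ∀ W, 0 ≤ F W)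
    (W : Finset V) : 0 ≤ closeB entb b F W := by
  unfold closeB
  split_ifs <;> exact hF0 _

omit [Field R] [IsStrictOrderedRing R] in
/-- `closeB` of a decreasing head is decreasing. -/
lemma closeB_mono (entb : Finset V) (b : V) (F : Finset V → R)
    (hmono : ∀ s t : Finset V, s ⊆ t → F t ≤ F s) :
    ∀ s t : Finset V, s ⊆ t → closeB entb b F t ≤ closeB entb b F s := by
  intro s t hst
  unfold closeB
  by_cases hs : ∃ r ∈ entb, r ∈ s
  · obtain ⟨r, hr, hrs⟩ := hs
    rw [if_pos ⟨r, hr, hst hrs⟩, if_pos ⟨r, hr, hrs⟩]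
    exact hmono _ _ (Finset.union_subset_union_left hst)
  · rw [if_neg hs]
    split_ifs with ht
    · exact (hmono _ _ Finset.subset_union_left).trans (hmono _ _ hst)
    · exact hmono _ _ hst

omit [LinearOrder R] [IsStrictOrderedRing R] in
/-- `(s ∪ {b}) ∩ (t ∪ {b}) = (s ∩ t) ∪ {b}`. -/
lemma union_singleton_inter_union_singleton (s t : Finset V) (b : V) :
    (s ∪ {b}) ∩ (t ∪ {b}) = (s ∩ t) ∪ {b} := by
  ext x
  simp only [Finset.mem_inter, Finset.mem_union, Finset.mem_singleton]
  tauto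

omit [LinearOrder R] [IsStrictOrderedRing R] in
/-- `(s ∪ {b}) ∪ (t ∪ {b}) = (s ∪ t) ∪ {b}`. -/
lemma union_singleton_union_union_singleton (s t : Finset V) (b : V) :
    (s ∪ {b}) ∪ (t ∪ {b}) = (s ∪ t) ∪ {b} := by
  ext x
  simp only [Finset.mem_union, Finset.mem_singleton]
  tauto

omit [LinearOrder R] [IsStrictOrderedRing R] in
/-- `(s ∪ {b}) ∩ t = s ∩ t` when `b ∉ t`. -/
lemma union_singleton_inter_of_notMem (s t : Finset V) {b : V} (hbt : b ∉ t) :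
    (s ∪ {b}) ∩ t = s ∩ t := by
  ext x
  simp only [Finset.mem_inter, Finset.mem_union, Finset.mem_singleton]
  constructor
  · rintro ⟨hx | rfl, hxt⟩
    · exact ⟨hx, hxt⟩
    · exact absurd hxt hbt
  · rintro ⟨hxs, hxt⟩
    exact ⟨Or.inl hxs, hxt⟩

omit [LinearOrder R] [IsStrictOrderedRing R] in
/-- `(s ∪ {b}) ∪ t = (s ∪ t) ∪ {b}`. -/
lemma union_singleton_union_eq (s t : Finset V) (b : V) : (s ∪ {b}) ∪ t = (s ∪ t) ∪ {b} := by
  ext x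
  simp only [Finset.mem_union, Finset.mem_singleton]
  tauto

/-- **`closeB` of a nonnegative, decreasing, log-supermodular head is log-supermodular** on sets
not containing `b`. -/
lemma closeB_lsm (entb : Finset V) (b : V) (F : Finset V → R) (hF0 : ∀ W, 0 ≤ F W)
    (hF : ∀ s t : Finset V, F s * F t ≤ F (s ∩ t) * F (s ∪ t))
    (hmono : ∀ s t : Finset V, s ⊆ t → F t ≤ F s)
    {s t : Finset V} (hbs : b ∉ s) (hbt : b ∉ t) :
    closeB entb b F s * closeB entb b F t ≤ closeB entb b F (s ∩ t) * closeB entb b F (s ∪ t) := by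
  have hno_inter : ∀ {x y : Finset V}, ¬ (∃ r ∈ entb, r ∈ y) → ¬ (∃ r ∈ entb, r ∈ x ∩ y) := by
    rintro x y hy ⟨r, hr, hrxy⟩
    exact hy ⟨r, hr, (Finset.mem_inter.1 hrxy).2⟩
  have hno_inter' : ∀ {x y : Finset V}, ¬ (∃ r ∈ entb, r ∈ x) → ¬ (∃ r ∈ entb, r ∈ x ∩ y) := by
    rintro x y hx ⟨r, hr, hrxy⟩
    exact hx ⟨r, hr, (Finset.mem_inter.1 hrxy).1⟩
  have hun : ∀ {x y : Finset V}, (∃ r ∈ entb, r ∈ x) → ∃ r ∈ entb, r ∈ x ∪ y := by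
    rintro x y ⟨r, hr, hrx⟩
    exact ⟨r, hr, Finset.mem_union_left _ hrx⟩
  have hun' : ∀ {x y : Finset V}, (∃ r ∈ entb, r ∈ y) → ∃ r ∈ entb, r ∈ x ∪ y := by
    rintro x y ⟨r, hr, hry⟩
    exact ⟨r, hr, Finset.mem_union_right _ hry⟩
  unfold closeB
  by_cases hs : ∃ r ∈ entb, r ∈ s <;> by_cases ht : ∃ r ∈ entb, r ∈ t
  · -- both entered
    rw [if_pos hs, if_pos ht, if_pos (hun hs)]
    have h1 := hF (s ∪ {b}) (t ∪ {b})
    rw [union_singleton_inter_union_singleton, union_singleton_union_union_singleton] at h1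
    refine h1.trans (mul_le_mul_of_nonneg_right ?_ (hF0 _))
    split_ifs
    · exact le_refl _
    · exact hmono _ _ Finset.subset_union_left
  · -- `s` entered, `t` not
    rw [if_pos hs, if_neg ht, if_neg (hno_inter ht), if_pos (hun hs)]
    have h1 := hF (s ∪ {b}) t
    rw [union_singleton_inter_of_notMem s t hbt, union_singleton_union_eq] at h1
    exact h1
  · -- `t` entered, `s` not
    rw [if_neg hs, if_pos ht, if_neg (hno_inter' hs), if_pos (hun' ht)]
    have h1 := hF s (t ∪ {b})
    have e1 : s ∩ (t ∪ {b}) = s ∩ t := by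
      ext x
      simp only [Finset.mem_inter, Finset.mem_union, Finset.mem_singleton]
      constructor
      · rintro ⟨hxs, hxt | rfl⟩
        · exact ⟨hxs, hxt⟩
        · exact absurd hxs hbs
      · rintro ⟨hxs, hxt⟩
        exact ⟨hxs, Or.inl hxt⟩
    have e2 : s ∪ (t ∪ {b}) = (s ∪ t) ∪ {b} := by
      ext x
      simp only [Finset.mem_union, Finset.mem_singleton]
      tauto
    rw [e1, e2] at h1
    exact h1
  · -- neither
    have hst : ¬ ∃ r ∈ entb, r ∈ s ∪ t := by
      rintro ⟨r, hr, hrst⟩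
      rcases Finset.mem_union.1 hrst with h | h
      · exact hs ⟨r, hr, h⟩
      · exact ht ⟨r, hr, h⟩
    rw [if_neg hs, if_neg ht, if_neg (hno_inter ht), if_neg hst]
    exact hF s t

end CloseB

end Summit.Ventures.PercRepro2.Coin
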